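/-
Copyright (c) 2026 the pub-hodgecm-mathlib formalisation cell (harness21).  Prover seat hodgecm-mathlib-F0P3a-p04 (g19): road «S3-ram» (LEAD F0P3a-plan (g12∕g13); junction
pen F0P3a-p01 (g17), J-PACK v2-iso socket S2; owner F0P3a-p06 (g15)); 2026-09-02.
-/
import Literature.NumberTheory.Automorphic.UnitaryLatticeTreeFixedChildSameLevelRamified    -- ★ (this seat): same-level neighbour criterion; brings ★ H∕J∕G∕F, ★ O-LBL, ★ L
import HarnessLib

/-!
# The lattice graph of a hermitian space — EIGENLINE PROPAGATION AT ODD LEVEL (tame-ramified place): through a first-order eigenline of a fixed vertex of ODD level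
# `d`, every grandchild keeps the level `ϖ^d` — the second-order condition is automatic in `U(σ, J₀)` (Bruhat–Tits 1972 §10; Tits 1979 §3.5; Kottwitz 1986 §3)

Topic `NumberTheory/Automorphic`; namespace `Literature.NumberTheory.Automorphic.UnitaryLatticeTree`.  THEOREMS ONLY (no definition, no instance, no notation, no named fact,
no `sorry`); kernel lane `--supports stmt-HodgeConjecture-24833`.  Cell `pub/hodgecm-mathlib` (D-0151), crux H413; road «S3-ram» (Literature seeding, count-neutral); the
(a2) JUNCTION of the type-(1) ramified row, second wave J-PACK v2-iso (pen F0P3a-p01 (g17), skeleton v4): the lattice half of socket S2 `row_offRegionLabels` (this seat) and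
of the AXIS rows (F0P3-p03 (g15), F0P3a-p02 (g17)).

THE POINT.  At a vertex with frame matrix `M = κ⁻¹(γ−1)κ` of level `ϖ^d` (`κ, γ ∈ U(σ,J₀)`), the neighbour `Λ′ = latt(κ·g(a,b))` through the line `x̄ = κe₀` keeps the
level (`(γ−1)Λ′ ⊆ ϖ^dΛ′`) iff `M₁₀ ≡ M₂₁ ≡ 0`, and `a·M₂₀ + ϖb·(M₂₂ − M₀₀) ≡ 0 (ϖ^{d+2})` (★ `map_sub_one_childLatt_le_scaleLattice_iff_lower`).  A FIRST-ORDER EIGENLINE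
(`M₁₀ ≡ M₂₀ ≡ 0 (ϖ^{d+1})`, residually `Ȳx̄ ∈ 𝓀x̄`) supplies the first condition; in `U(σ, J₀)` at a RAMIFIED place (`σϖ = −ϖ`, `σ` residually trivial) AND ODD `d` it supplies
the rest: the first-order skew-hermitian law ★ `v_coe_sub_one_apply_add_sigma_rev_le` (`Y_{ij} + σ(Y_{rev j, rev i}) ≡ 0 (ϖ^{2d})`, `Y = g − 1`, `g` unitary of level `ϖ^d`)
combined with the PARITY RULE `σ(z) ≡ (−1)^n·z (ϖ^{n+1})` for `|z| ≤ |ϖ|^n` (§1) gives at odd `d`: `Y₂₁ ≡ 0 ⟸ Y₁₀ ≡ 0`, `Y₂₂ ≡ Y₀₀ (ϖ^{d+1})` always, and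
`Y₂₀ ≡ 0 (ϖ^{d+1}) ⇒ Y₂₀ ≡ 0 (ϖ^{d+2})` (`2Y₂₀ ≡ (Y₂₀ + σY₂₀) − (σY₂₀ − Y₂₀)`, `|2| = 1`) — §2.  Hence §3 **EIGENLINE PROPAGATION**: through a first-order eigenline of
an odd-level vertex EVERY grandchild keeps the level (the «axis» of the isoceles literals, where `d₀` is odd because the eigenvalues are norm-one units: §1
`odd_of_v_sub_eq_of_mul_map_eq_one`), and contrapositively the PIVOT `|M₁₀| = |ϖ|^d` holds through a null line as soon as ONE grandchild drops the level — no `SS`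
(second-order ∕ semisimplicity) token is needed (the abstract failure `SS(ϖ^{2d+1}) ⇏ SS(ϖ^{2d+2})` of F0P3-p03 (g15)'s keying note lives at EVEN `d` only).

* §1 `v_map_sub_neg_one_pow_mul_le` (parity rule), **`odd_of_v_sub_eq_of_mul_map_eq_one`** (a difference of norm-one units has ODD order).
* §2 `v_coe_sub_one_two_one_le_of_one_zero_le`, `v_coe_sub_one_two_two_sub_zero_zero_le_of_odd`, `v_coe_sub_one_two_zero_le_of_odd` (the three odd-level congruences).
* §3 **`map_sub_one_childLatt_le_scaleLattice_of_eigenline_of_odd`** (EIGENLINE PROPAGATION), **`v_one_zero_eq_of_corner_of_not_map_sub_one_childLatt_le`** (the pivot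
  through a null line with a grandchild off the level).

HONEST LABEL: HC_CM is proved only modulo the 2 remaining named inputs (hLiu418 24832, h413 24833) until rung 0 closes; nothing printed is asserted here (elementary algebra
over a valuation ring); «S3-ram» has no books consequence.

## References
* [BruhatTits1972] F. Bruhat, J. Tits, *Groupes réductifs sur un corps local I*, Publ. Math. IHÉS 41 (1972), §10 (lattice models; vertex stabilisers and their filtrations).
* [Tits1979] J. Tits, *Reductive groups over local fields*, PSPM 33.1 (1979), §3.5 (congruence filtration at a ramified place; reduction mod `𝔭`).
* [Kottwitz1986] R. E. Kottwitz, *Base change for unit elements of Hecke algebras*, Compositio Math. 60 (1986), §3 (levels of fixed lattices; shell recursion).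
* [Serre1980Trees] J.-P. Serre, *Trees* (1980), Ch. II §1.1–1.2 (lattices, neighbours, levels).
-/

set_option autoImplicit false

noncomputable section

open scoped Valued WithZero Matrix MatrixGroups

namespace Literature.NumberTheory.Automorphic.UnitaryLatticeTree

open Literature.NumberTheory.Automorphic Literature.NumberTheory.Automorphic.HermitianLattice

variable {K : Type*} [Field K] [Valued K ℤᵐ⁰] {σ : K →+* K} {ϖ : K}

/-! ## §1 The parity rule at a ramified place; norm-one differences have odd order -/

/-- **THE PARITY RULE**: at a ramified place (`σϖ = −ϖ`, `σ` residually trivial, valuation-preserving), `|z| ≤ |ϖ|^n` implies `|σ(z) − (−1)^n·z| ≤ |ϖ|^{n+1}`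
(`z = ϖ^n·m`, `σ(z) = (−ϖ)^n·σ(m)`, `σ(m) ≡ m`). [cite: Tits1979, §3.5] [cite: BruhatTits1972, §10] -/
theorem v_map_sub_neg_one_pow_mul_le (hσϖ : σ ϖ = -ϖ) (hϖ : Valued.v ϖ = WithZero.exp (-1 : ℤ))
    (hres : ∀ x : K, Valued.v x ≤ 1 → Valued.v (σ x - x) < 1) {z : K} {n : ℕ} (hz : Valued.v z ≤ Valued.v ϖ ^ n) :
    Valued.v (σ z - (-1) ^ n * z) ≤ Valued.v ϖ ^ (n + 1) := by
  have hϖ0 : ϖ ≠ 0 := fun h0 => by rw [h0, map_zero] at hϖ; exact WithZero.coe_ne_zero hϖ.symm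
  have hvϖ0 : Valued.v ϖ ≠ 0 := (Valuation.ne_zero_iff _).2 hϖ0
  have hpow0 : (ϖ : K) ^ n ≠ 0 := pow_ne_zero _ hϖ0
  set m : K := z / ϖ ^ n with hmdef
  have hzm : z = ϖ ^ n * m := by rw [hmdef, mul_div_cancel₀ _ hpow0]
  have hm : Valued.v m ≤ 1 := by
    rw [hmdef, map_div₀, map_pow, div_le_one₀ (pow_pos (zero_lt_iff.2 hvϖ0) _)]; exact hz
  have hσm : Valued.v (σ m - m) ≤ Valued.v ϖ := by
    have h1 : (1 : ℤᵐ⁰) = Valued.v ϖ * WithZero.exp (1 : ℤ) := by rw [hϖ, ← WithZero.exp_add]; norm_num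
    have h := hres m hm
    rw [h1] at h
    exact (WithZero.lt_mul_exp_iff_le hvϖ0).1 h
  have key : σ z - (-1) ^ n * z = (-1) ^ n * ϖ ^ n * (σ m - m) := by
    rw [hzm, map_mul, map_pow, hσϖ, neg_pow]; ring
  rw [key, map_mul, map_mul, map_pow, Valuation.map_neg, map_one, one_pow, one_mul, map_pow, pow_succ]
  exact mul_le_mul' le_rfl hσm

/-- **A DIFFERENCE OF NORM-ONE UNITS HAS ODD ORDER** at a ramified place: if `s·σ(s) = s′·σ(s′) = 1` and `|s − s′| = |ϖ|^n` with `n ≠ 0`, then `n` is odd (with `x = s − s′`,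
`y = x·σ(s′)`: `y + σ(y) = −x·σ(x)` has order `2n`, while for even `n` the parity rule gives `|y + σ(y)| = |2y| = |ϖ|^n`).  In particular every depth of a norm-one torus
element at a tame-ramified place is odd (Rogawski's `N = 2n+1`). [cite: Tits1979, §3.5] [cite: BruhatTits1972, §10] -/
theorem odd_of_v_sub_eq_of_mul_map_eq_one (hσ : ∀ x, σ (σ x) = x) (hvσ : ∀ z, Valued.v (σ z) = Valued.v z) (hσϖ : σ ϖ = -ϖ) (hϖ : Valued.v ϖ = WithZero.exp (-1 : ℤ))
    (hres : ∀ x : K, Valued.v x ≤ 1 → Valued.v (σ x - x) < 1) (h2 : Valued.v (2 : K) = 1)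
    {s s' : K} (hs : s * σ s = 1) (hs' : s' * σ s' = 1) {n : ℕ} (hn : n ≠ 0) (h : Valued.v (s - s') = Valued.v ϖ ^ n) : Odd n := by
  have hϖ0 : ϖ ≠ 0 := fun h0 => by rw [h0, map_zero] at hϖ; exact WithZero.coe_ne_zero hϖ.symm
  have hvϖ0 : Valued.v ϖ ≠ 0 := (Valuation.ne_zero_iff _).2 hϖ0
  have hϖlt : Valued.v ϖ < 1 := by rw [hϖ, ← WithZero.exp_zero]; exact WithZero.exp_lt_exp.2 (by norm_num)
  by_contra hodd
  rw [Nat.not_odd_iff_even] at hodd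
  set x : K := s - s' with hxdef
  set y : K := x * σ s' with hydef
  have hs'v : Valued.v s' = 1 := by
    have h1 : Valued.v s' * Valued.v s' = 1 := by
      have h0 := congrArg Valued.v hs'
      rwa [map_mul, map_one, hvσ] at h0
    rcases lt_trichotomy (Valued.v s') 1 with hlt | heq | hgt
    · refine absurd h1 (ne_of_lt ?_)
      calc Valued.v s' * Valued.v s' ≤ Valued.v s' * 1 := mul_le_mul' le_rfl hlt.le
        _ < 1 := by rw [mul_one]; exact hlt
    · exact heq
    · refine absurd h1 (ne_of_gt ?_)
      calc (1 : ℤᵐ⁰) < Valued.v s' := hgt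
        _ = Valued.v s' * 1 := (mul_one _).symm
        _ ≤ Valued.v s' * Valued.v s' := mul_le_mul' le_rfl hgt.le
  have hy : Valued.v y = Valued.v ϖ ^ n := by rw [hydef, map_mul, hvσ, hs'v, mul_one, h]
  -- `y + σ y = −x·σ x`
  have hid : y + σ y = -(x * σ x) := by
    have e : s = s' + x := by rw [hxdef]; ring
    have hσy : σ y = σ x * s' := by rw [hydef, map_mul, hσ]
    rw [e, map_add] at hs
    rw [hσy, hydef]
    linear_combination hs - hs'
  -- for even `n`: `|y + σ y| = |2y| = |ϖ|^n`
  have hpar := v_map_sub_neg_one_pow_mul_le hσϖ hϖ hres hy.le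
  rw [hodd.neg_one_pow, one_mul] at hpar
  have h2y : Valued.v (2 * y) = Valued.v ϖ ^ n := by rw [map_mul, h2, one_mul, hy]
  have hlt1 : Valued.v ϖ ^ (n + 1) < Valued.v ϖ ^ n := by
    rw [pow_succ]; exact mul_lt_of_lt_one_right (pow_pos (zero_lt_iff.2 hvϖ0) _) hϖlt
  have hsum : Valued.v (y + σ y) = Valued.v ϖ ^ n := by
    rw [show y + σ y = 2 * y + (σ y - y) by ring, Valuation.map_add_eq_of_lt_left _ ((hpar.trans_lt hlt1).trans_eq h2y.symm), h2y]
  -- but `|x·σ x| = |ϖ|^{2n} < |ϖ|^n`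
  have hxx : Valued.v (-(x * σ x)) = Valued.v ϖ ^ n * Valued.v ϖ ^ n := by rw [Valuation.map_neg, map_mul, hvσ, h]
  have hlt2 : Valued.v ϖ ^ n * Valued.v ϖ ^ n < Valued.v ϖ ^ n :=
    mul_lt_of_lt_one_left (pow_pos (zero_lt_iff.2 hvϖ0) _) (pow_lt_one₀ zero_le hϖlt hn)
  rw [hid, hxx] at hsum
  exact absurd hsum (ne_of_lt hlt2)

/-! ## §2 The three odd-level congruences in `U(σ, J₀)` -/

/-- **`Y₁₀ ≡ 0 ⇒ Y₂₁ ≡ 0 (mod ϖ^{d+1})`** for `Y = g − 1`, `g ∈ U(σ, J₀)` of level `ϖ^d`, `d ≥ 1` (skew-hermitian law at `(1,0)`: `Y₁₀ + σY₂₁ ≡ 0 (ϖ^{2d})`; no parity).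
[cite: Tits1979, §3.5] [cite: BruhatTits1972, §10] -/
theorem v_coe_sub_one_two_one_le_of_one_zero_le (hvσ : ∀ z, Valued.v (σ z) = Valued.v z) (hϖ : Valued.v ϖ = WithZero.exp (-1 : ℤ))
    (γ : unitaryGroupOfForm σ ((StdForm.antidiagonal 3).over K)) {d : ℕ} (hd : 1 ≤ d)
    (hY : ∀ i j, Valued.v ((((γ : GL (Fin 3) K) : Matrix (Fin 3) (Fin 3) K) - 1) i j) ≤ Valued.v ϖ ^ d)
    (h10 : Valued.v ((((γ : GL (Fin 3) K) : Matrix (Fin 3) (Fin 3) K) - 1) 1 0) ≤ Valued.v ϖ ^ (d + 1)) :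
    Valued.v ((((γ : GL (Fin 3) K) : Matrix (Fin 3) (Fin 3) K) - 1) 2 1) ≤ Valued.v ϖ ^ (d + 1) := by
  have hϖ1 : Valued.v ϖ ≤ 1 := by rw [hϖ, ← WithZero.exp_zero]; exact WithZero.exp_le_exp.2 (by norm_num)
  set Y : Matrix (Fin 3) (Fin 3) K := ((γ : GL (Fin 3) K) : Matrix (Fin 3) (Fin 3) K) - 1 with hYdef
  have h := v_coe_sub_one_apply_add_sigma_rev_le hvσ γ hY 1 0
  have hr0 : (0 : Fin 3).rev = 2 := rfl
  have hr1 : (1 : Fin 3).rev = 1 := rfl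
  rw [hr0, hr1] at h
  have h2d : Valued.v ϖ ^ d * Valued.v ϖ ^ d ≤ Valued.v ϖ ^ (d + 1) := by
    rw [← pow_add]; exact pow_le_pow_right_of_le_one' hϖ1 (by omega)
  have hσ21 : Valued.v (σ (Y 2 1)) ≤ Valued.v ϖ ^ (d + 1) := by
    rw [show σ (Y 2 1) = (Y 1 0 + σ (Y 2 1)) - Y 1 0 by ring]
    exact (Valuation.map_sub _ _ _).trans (max_le (h.trans h2d) h10)
  rwa [hvσ] at hσ21

/-- **`Y₂₂ ≡ Y₀₀ (mod ϖ^{d+1})` at ODD level** for `Y = g − 1`, `g ∈ U(σ, J₀)` of level `ϖ^d` (`d ≥ 1`, ramified place): skew-hermitian law at `(0,0)` (`Y₀₀ + σY₂₂ ≡ 0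
(ϖ^{2d})`) and the parity rule (`σY₂₂ ≡ −Y₂₂ (ϖ^{d+1})`). [cite: Tits1979, §3.5] [cite: BruhatTits1972, §10] -/
theorem v_coe_sub_one_two_two_sub_zero_zero_le_of_odd (hvσ : ∀ z, Valued.v (σ z) = Valued.v z) (hσϖ : σ ϖ = -ϖ) (hϖ : Valued.v ϖ = WithZero.exp (-1 : ℤ))
    (hres : ∀ x : K, Valued.v x ≤ 1 → Valued.v (σ x - x) < 1)
    (γ : unitaryGroupOfForm σ ((StdForm.antidiagonal 3).over K)) {d : ℕ} (hd : 1 ≤ d) (hodd : Odd d)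
    (hY : ∀ i j, Valued.v ((((γ : GL (Fin 3) K) : Matrix (Fin 3) (Fin 3) K) - 1) i j) ≤ Valued.v ϖ ^ d) :
    Valued.v ((((γ : GL (Fin 3) K) : Matrix (Fin 3) (Fin 3) K) - 1) 2 2 - (((γ : GL (Fin 3) K) : Matrix (Fin 3) (Fin 3) K) - 1) 0 0) ≤ Valued.v ϖ ^ (d + 1) := by
  have hϖ1 : Valued.v ϖ ≤ 1 := by rw [hϖ, ← WithZero.exp_zero]; exact WithZero.exp_le_exp.2 (by norm_num)
  set Y : Matrix (Fin 3) (Fin 3) K := ((γ : GL (Fin 3) K) : Matrix (Fin 3) (Fin 3) K) - 1 with hYdef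
  have h := v_coe_sub_one_apply_add_sigma_rev_le hvσ γ hY 0 0
  have hr0 : (0 : Fin 3).rev = 2 := rfl
  rw [hr0] at h
  have h2d : Valued.v ϖ ^ d * Valued.v ϖ ^ d ≤ Valued.v ϖ ^ (d + 1) := by
    rw [← pow_add]; exact pow_le_pow_right_of_le_one' hϖ1 (by omega)
  have hpar := v_map_sub_neg_one_pow_mul_le hσϖ hϖ hres (hY 2 2)
  rw [hodd.neg_one_pow] at hpar
  rw [show Y 2 2 - Y 0 0 = (σ (Y 2 2) - (-1) * Y 2 2) - (Y 0 0 + σ (Y 2 2)) by ring]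
  exact (Valuation.map_sub _ _ _).trans (max_le hpar (h.trans h2d))

/-- **`Y₂₀ ≡ 0 (ϖ^{d+1}) ⇒ Y₂₀ ≡ 0 (ϖ^{d+2})` at ODD level `d ≥ 2`** for `Y = g − 1`, `g ∈ U(σ, J₀)` of level `ϖ^d` (ramified place, `|2| = 1`): skew-hermitian law at
`(2,0)` (`Y₂₀ + σY₂₀ ≡ 0 (ϖ^{2d})`) and the parity rule at the EVEN exponent `d + 1` (`σY₂₀ ≡ +Y₂₀ (ϖ^{d+2})`): `2Y₂₀ ≡ 0`.  The SECOND-ORDER NULLITY of an isotropic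
eigenline is automatic. [cite: Tits1979, §3.5] [cite: BruhatTits1972, §10] [cite: Kottwitz1986, §3] -/
theorem v_coe_sub_one_two_zero_le_of_odd (hvσ : ∀ z, Valued.v (σ z) = Valued.v z) (hσϖ : σ ϖ = -ϖ) (hϖ : Valued.v ϖ = WithZero.exp (-1 : ℤ))
    (hres : ∀ x : K, Valued.v x ≤ 1 → Valued.v (σ x - x) < 1) (h2 : Valued.v (2 : K) = 1)
    (γ : unitaryGroupOfForm σ ((StdForm.antidiagonal 3).over K)) {d : ℕ} (hd : 2 ≤ d) (hodd : Odd d)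
    (hY : ∀ i j, Valued.v ((((γ : GL (Fin 3) K) : Matrix (Fin 3) (Fin 3) K) - 1) i j) ≤ Valued.v ϖ ^ d)
    (h20 : Valued.v ((((γ : GL (Fin 3) K) : Matrix (Fin 3) (Fin 3) K) - 1) 2 0) ≤ Valued.v ϖ ^ (d + 1)) :
    Valued.v ((((γ : GL (Fin 3) K) : Matrix (Fin 3) (Fin 3) K) - 1) 2 0) ≤ Valued.v ϖ ^ (d + 2) := by
  have hϖ1 : Valued.v ϖ ≤ 1 := by rw [hϖ, ← WithZero.exp_zero]; exact WithZero.exp_le_exp.2 (by norm_num)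
  set Y : Matrix (Fin 3) (Fin 3) K := ((γ : GL (Fin 3) K) : Matrix (Fin 3) (Fin 3) K) - 1 with hYdef
  have h := v_coe_sub_one_apply_add_sigma_rev_le hvσ γ hY 2 0
  have hr0 : (0 : Fin 3).rev = 2 := rfl
  have hr2 : (2 : Fin 3).rev = 0 := rfl
  rw [hr0, hr2] at h
  have h2d : Valued.v ϖ ^ d * Valued.v ϖ ^ d ≤ Valued.v ϖ ^ (d + 2) := by
    rw [← pow_add]; exact pow_le_pow_right_of_le_one' hϖ1 (by omega)
  have hpar := v_map_sub_neg_one_pow_mul_le hσϖ hϖ hres h20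
  have heven : Even (d + 1) := hodd.add_one
  rw [heven.neg_one_pow, one_mul] at hpar
  have h2Y : Valued.v (2 * Y 2 0) ≤ Valued.v ϖ ^ (d + 2) := by
    rw [show 2 * Y 2 0 = (Y 2 0 + σ (Y 2 0)) - (σ (Y 2 0) - Y 2 0) by ring]
    exact (Valuation.map_sub _ _ _).trans (max_le (h.trans h2d) hpar)
  rwa [map_mul, h2, one_mul] at h2Y

/-! ## §3 Eigenline propagation at odd level, and the pivot through a null line with a grandchild off the level -/

/-- **EIGENLINE PROPAGATION AT ODD LEVEL.**  `κ, γ ∈ U(σ, J₀)`, `M = κ⁻¹(γ−1)κ` of ODD level `d ≥ 2` (ramified place, `|2| = 1`), and the line `x̄ = κe₀` a FIRST-ORDER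
EIGENLINE (`|M₁₀|, |M₂₀| ≤ |ϖ|^{d+1}`): then EVERY neighbour `Λ′ = latt(κ·g(a,b))` through `x̄` (`|a| = 1`, `|b| ≤ 1`) keeps the level — `(γ−1)·Λ′ ⊆ ϖ^d·Λ′`.
(§2 supplies `M₂₁ ≡ 0`, `M₂₂ ≡ M₀₀ (ϖ^{d+1})`, `M₂₀ ≡ 0 (ϖ^{d+2})` for the unitary `κ⁻¹γκ`; then ★ `map_sub_one_childLatt_le_scaleLattice_iff_lower`.)  This is the axis
mechanism of the isoceles literals. [cite: Kottwitz1986, §3] [cite: BruhatTits1972, §10] [cite: Tits1979, §3.5] -/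
theorem map_sub_one_childLatt_le_scaleLattice_of_eigenline_of_odd (hvσ : ∀ z, Valued.v (σ z) = Valued.v z) (hσϖ : σ ϖ = -ϖ) (hϖ : Valued.v ϖ = WithZero.exp (-1 : ℤ))
    (hres : ∀ x : K, Valued.v x ≤ 1 → Valued.v (σ x - x) < 1) (h2 : Valued.v (2 : K) = 1)
    (κ γ : unitaryGroupOfForm σ ((StdForm.antidiagonal 3).over K)) {a b : K} (ha : Valued.v a = 1) (hb : Valued.v b ≤ 1) {d : ℕ} (hd : 2 ≤ d) (hodd : Odd d)
    (hM : ∀ i j, Valued.v (((((κ : GL (Fin 3) K)⁻¹ : GL (Fin 3) K) : Matrix (Fin 3) (Fin 3) K) * (((γ : GL (Fin 3) K) : Matrix (Fin 3) (Fin 3) K) - 1) *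
      ((κ : GL (Fin 3) K) : Matrix (Fin 3) (Fin 3) K)) i j) ≤ Valued.v ϖ ^ d)
    (h10 : Valued.v (((((κ : GL (Fin 3) K)⁻¹ : GL (Fin 3) K) : Matrix (Fin 3) (Fin 3) K) * (((γ : GL (Fin 3) K) : Matrix (Fin 3) (Fin 3) K) - 1) *
      ((κ : GL (Fin 3) K) : Matrix (Fin 3) (Fin 3) K)) 1 0) ≤ Valued.v ϖ ^ (d + 1))
    (h20 : Valued.v (((((κ : GL (Fin 3) K)⁻¹ : GL (Fin 3) K) : Matrix (Fin 3) (Fin 3) K) * (((γ : GL (Fin 3) K) : Matrix (Fin 3) (Fin 3) K) - 1) *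
      ((κ : GL (Fin 3) K) : Matrix (Fin 3) (Fin 3) K)) 2 0) ≤ Valued.v ϖ ^ (d + 1)) :
    (latt (((κ : GL (Fin 3) K) : Matrix (Fin 3) (Fin 3) K) * !![a / ϖ, 0, 0; 0, 1, 0; b, 0, ϖ])).map
        ((Matrix.toLin' (((γ : GL (Fin 3) K) : Matrix (Fin 3) (Fin 3) K) - 1)).restrictScalars 𝒪[K]) ≤
      scaleLattice (ϖ ^ d) (latt (((κ : GL (Fin 3) K) : Matrix (Fin 3) (Fin 3) K) * !![a / ϖ, 0, 0; 0, 1, 0; b, 0, ϖ])) := by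
  set M : Matrix (Fin 3) (Fin 3) K := (((κ : GL (Fin 3) K)⁻¹ : GL (Fin 3) K) : Matrix (Fin 3) (Fin 3) K) * (((γ : GL (Fin 3) K) : Matrix (Fin 3) (Fin 3) K) - 1) *
      ((κ : GL (Fin 3) K) : Matrix (Fin 3) (Fin 3) K) with hMdef
  -- `M = (κ⁻¹γκ) − 1` for the unitary `κ⁻¹γκ`
  have hY : ∀ i j, Valued.v (((((κ⁻¹ * γ * κ : unitaryGroupOfForm σ ((StdForm.antidiagonal 3).over K)) : GL (Fin 3) K) : Matrix (Fin 3) (Fin 3) K) - 1) i j) ≤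
      Valued.v ϖ ^ d := by
    intro i j; rw [coe_inv_mul_mul_sub_one]; exact hM i j
  have h21 := v_coe_sub_one_two_one_le_of_one_zero_le hvσ hϖ (κ⁻¹ * γ * κ) (by omega) hY (by rw [coe_inv_mul_mul_sub_one]; exact h10)
  have h2200 := v_coe_sub_one_two_two_sub_zero_zero_le_of_odd hvσ hσϖ hϖ hres (κ⁻¹ * γ * κ) (by omega) hodd hY
  have h20' := v_coe_sub_one_two_zero_le_of_odd hvσ hσϖ hϖ hres h2 (κ⁻¹ * γ * κ) hd hodd hY (by rw [coe_inv_mul_mul_sub_one]; exact h20)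
  rw [coe_inv_mul_mul_sub_one] at h21 h2200 h20'
  refine (map_sub_one_childLatt_le_scaleLattice_iff_lower hϖ (κ : GL (Fin 3) K) (γ : GL (Fin 3) K) ha hb hM).2 ⟨h10, h21, ?_⟩
  refine (Valuation.map_add _ _ _).trans (max_le ?_ ?_)
  · rw [map_mul, ha, one_mul]; exact h20'
  · rw [map_mul, map_mul]
    calc Valued.v ϖ * Valued.v b * Valued.v (M 2 2 - M 0 0) ≤ Valued.v ϖ * 1 * Valued.v ϖ ^ (d + 1) := mul_le_mul' (mul_le_mul' le_rfl hb) h2200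
      _ = Valued.v ϖ ^ (d + 2) := by rw [mul_one, ← pow_succ']

/-- **THE PIVOT THROUGH A NULL LINE WITH A GRANDCHILD OFF THE LEVEL.**  Same data (odd level `d ≥ 2`); if the corner passes (`|M₂₀| ≤ |ϖ|^{d+1}`: the line is `Q_Ȳ`-null)
and SOME neighbour `Λ′ = latt(κ·g(a,b))` through it does NOT keep the level, then `x̄` is not an eigenline, i.e. the pivot holds: **`|M₁₀| = |ϖ|^d`** — the input of ★ H
`not_map_sub_one_childLatt_le_scaleLattice_of_pivot` ∕ `map_sub_one_sq_childLatt_le_scaleLattice_iff_of_corner` (label `(d−1, rank 2)` of EVERY grandchild through `x̄`).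
[cite: Kottwitz1986, §3] [cite: BruhatTits1972, §10] [cite: Tits1979, §3.5] -/
theorem v_one_zero_eq_of_corner_of_not_map_sub_one_childLatt_le (hvσ : ∀ z, Valued.v (σ z) = Valued.v z) (hσϖ : σ ϖ = -ϖ) (hϖ : Valued.v ϖ = WithZero.exp (-1 : ℤ))
    (hres : ∀ x : K, Valued.v x ≤ 1 → Valued.v (σ x - x) < 1) (h2 : Valued.v (2 : K) = 1)
    (κ γ : unitaryGroupOfForm σ ((StdForm.antidiagonal 3).over K)) {a b : K} (ha : Valued.v a = 1) (hb : Valued.v b ≤ 1) {d : ℕ} (hd : 2 ≤ d) (hodd : Odd d)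
    (hM : ∀ i j, Valued.v (((((κ : GL (Fin 3) K)⁻¹ : GL (Fin 3) K) : Matrix (Fin 3) (Fin 3) K) * (((γ : GL (Fin 3) K) : Matrix (Fin 3) (Fin 3) K) - 1) *
      ((κ : GL (Fin 3) K) : Matrix (Fin 3) (Fin 3) K)) i j) ≤ Valued.v ϖ ^ d)
    (h20 : Valued.v (((((κ : GL (Fin 3) K)⁻¹ : GL (Fin 3) K) : Matrix (Fin 3) (Fin 3) K) * (((γ : GL (Fin 3) K) : Matrix (Fin 3) (Fin 3) K) - 1) *
      ((κ : GL (Fin 3) K) : Matrix (Fin 3) (Fin 3) K)) 2 0) ≤ Valued.v ϖ ^ (d + 1))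
    (hnot : ¬ (latt (((κ : GL (Fin 3) K) : Matrix (Fin 3) (Fin 3) K) * !![a / ϖ, 0, 0; 0, 1, 0; b, 0, ϖ])).map
        ((Matrix.toLin' (((γ : GL (Fin 3) K) : Matrix (Fin 3) (Fin 3) K) - 1)).restrictScalars 𝒪[K]) ≤
      scaleLattice (ϖ ^ d) (latt (((κ : GL (Fin 3) K) : Matrix (Fin 3) (Fin 3) K) * !![a / ϖ, 0, 0; 0, 1, 0; b, 0, ϖ]))) :
    Valued.v (((((κ : GL (Fin 3) K)⁻¹ : GL (Fin 3) K) : Matrix (Fin 3) (Fin 3) K) * (((γ : GL (Fin 3) K) : Matrix (Fin 3) (Fin 3) K) - 1) *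
      ((κ : GL (Fin 3) K) : Matrix (Fin 3) (Fin 3) K)) 1 0) = Valued.v ϖ ^ d := by
  have hϖ0 : ϖ ≠ 0 := fun h0 => by rw [h0, map_zero] at hϖ; exact WithZero.coe_ne_zero hϖ.symm
  have hvϖ0 : Valued.v ϖ ≠ 0 := (Valuation.ne_zero_iff _).2 hϖ0
  by_contra hne
  -- discreteness: `≤ |ϖ|^d` and `≠ |ϖ|^d` means `≤ |ϖ|^(d+1)`
  have hlt := lt_of_le_of_ne (hM 1 0) hne
  have hdm : Valued.v ϖ ^ d = Valued.v ϖ ^ (d + 1) * WithZero.exp (1 : ℤ) := by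
    rw [pow_succ, hϖ, mul_assoc, ← WithZero.exp_add]; norm_num
  rw [hdm] at hlt
  have h10 := (WithZero.lt_mul_exp_iff_le (pow_ne_zero _ hvϖ0)).1 hlt
  exact hnot (map_sub_one_childLatt_le_scaleLattice_of_eigenline_of_odd hvσ hσϖ hϖ hres h2 κ γ ha hb hd hodd hM h10 h20)

end Literature.NumberTheory.Automorphic.UnitaryLatticeTree

end
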